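import Mathlib
import HarnessLib
import Summits.HubbardSuperconductivity.HubbardSuperconductivity.Theorems.KLProgrammeKLRegimeSplitTwoLegSizesMSChainFrames
import Summits.HubbardSuperconductivity.HubbardSuperconductivity.Theorems.KLProgrammePerturbedFermiCurveCompChainStruct
import Summits.HubbardSuperconductivity.HubbardSuperconductivity.Theorems.KLProgrammeKLRegimeCountertermMuFlow

/-!
# Route `KLProgramme`, crux K3 — gen-5 ENGINE child (stmt-…-19918, `stub_twoLeg_step`, clause `TwoLegSizesMST`), recipe (L)+(F):
# CENTRED ANGULAR SIZES OF A CURVE PROFILE `S ∘ k_F^C` ((P4-c), step 4a: the `Gs (n+1)` entry — the base slot of the MS witness)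

Seat hubbard-kl-k3c3-p1 (g3).  For a symbol `S : TrigPolyC4v` with `|S| ≤ M 0`, `‖Dᵏ evalM S‖ ≤ M k` (`1 ≤ k ≤ 4`, e.g. `2·Mˢ_k` from the
increment kernel's position moments, p1b) and a frame `C` whose Fermi-point map `γ_C = toLp ∘ klFermiPoint μ C` is `C⁴` with
`‖γ_C⁽ⁱ⁾‖ ≤ D i` (`1 ≤ i ≤ 4`, k3c3-p3's size-keyed towers — for the chain frames: `chain_curve_sizes`), the profile `p = curveProfile μ S C = evalM S ∘ γ_C`
has CENTRED angular sizes `‖Dⁱ(p − mean p)‖ ≤ bellCum M D j` for all `i ≤ j ≤ 4`, where `bellCum` is the cumulative Bell sum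
`2M₀ | + M₁D₁ | + (M₂D₁² + M₁D₂) | + (M₃D₁³ + 3M₂D₁D₂ + M₁D₃) | + (M₄D₁⁴ + 6M₃D₁²D₂ + 3M₂D₂² + 4M₂D₁D₃ + M₁D₄)` — exactly the `hGs` input
of `twoLegSizesMST_succ_of_chain_sizes` for the slot `m = n+1`.  Proofs only; nothing about the model.
-/

noncomputable section

namespace Summit.HubbardSuperconductivity.HubbardSuperconductivity.Theorems.KLRegimeSplit

set_option linter.dupNamespace false -- summit = problem name (single-conjunct summit), D-0017

open Real Finset Literature.MathematicalPhysics.QuantumLattice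
open Summit.HubbardSuperconductivity.HubbardSuperconductivity.Theorems.PerturbedFermiCurve

/-- The Bell bound of order `i` (`1 ≤ i ≤ 4`; `0 ↦ 2M₀`, the centred sup). -/
def bellTerm (M D : ℕ → ℝ) : ℕ → ℝ
  | 0 => 2 * M 0
  | 1 => M 1 * D 1
  | 2 => M 2 * D 1 ^ 2 + M 1 * D 2
  | 3 => M 3 * D 1 ^ 3 + 3 * M 2 * D 1 * D 2 + M 1 * D 3
  | _ => M 4 * D 1 ^ 4 + 6 * M 3 * D 1 ^ 2 * D 2 + 3 * M 2 * D 2 ^ 2 + 4 * M 2 * D 1 * D 3 + M 1 * D 4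

/-- The CUMULATIVE Bell bound `Σ_{i ≤ j} bellTerm i` (a common bound for all orders `i ≤ j`). -/
def bellCum (M D : ℕ → ℝ) (j : ℕ) : ℝ := ∑ i ∈ range (j + 1), bellTerm M D i

/-- The Bell terms are nonnegative for nonnegative data. -/
theorem bellTerm_nonneg {M D : ℕ → ℝ} (hM : ∀ k, 0 ≤ M k) (hD : ∀ i, 0 ≤ D i) (i : ℕ) : 0 ≤ bellTerm M D i := by
  have := hM 0; have := hM 1; have := hM 2; have := hM 3; have := hM 4
  have := hD 1; have := hD 2; have := hD 3; have := hD 4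
  rcases i with _ | _ | _ | _ | _ <;> simp only [bellTerm] <;> positivity

/-- A single Bell term is below the cumulative bound. -/
theorem bellTerm_le_bellCum {M D : ℕ → ℝ} (hM : ∀ k, 0 ≤ M k) (hD : ∀ i, 0 ≤ D i) {i j : ℕ} (hij : i ≤ j) :
    bellTerm M D i ≤ bellCum M D j := by
  unfold bellCum
  exact Finset.single_le_sum (fun k _ => bellTerm_nonneg hM hD k) (mem_range.mpr (by omega))

/-- The curve profile is the symbol on `Momentum` composed with the `toLp`-curve. -/
theorem curveProfile_eq_comp (μ : ℝ) (S C : TrigPolyC4v) :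
    curveProfile μ S C = evalM S ∘ fun θ => (WithLp.toLp 2 (klFermiPoint μ C θ) : Momentum) := by
  funext θ; simp [curveProfile, evalM]

/-- **CENTRED ANGULAR SIZES OF A CURVE PROFILE.**  See the module docstring. -/
theorem curveProfile_centred_sizes (μ : ℝ) (S C : TrigPolyC4v)
    (hγ : ContDiff ℝ 4 (fun θ => (WithLp.toLp 2 (klFermiPoint μ C θ) : Momentum))) {M D : ℕ → ℝ}
    (hMnn : ∀ k, 0 ≤ M k) (hDnn : ∀ i, 0 ≤ D i) (hM0 : ∀ q : Momentum, |evalM S q| ≤ M 0)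
    (hM : ∀ k, 1 ≤ k → k ≤ 4 → ∀ q : Momentum, ‖iteratedFDeriv ℝ k (evalM S) q‖ ≤ M k)
    (hD : ∀ i, 1 ≤ i → i ≤ 4 → ∀ θ, ‖iteratedDeriv i (fun θ => (WithLp.toLp 2 (klFermiPoint μ C θ) : Momentum)) θ‖ ≤ D i)
    {j : ℕ} (hj : j ≤ 4) {i : ℕ} (hi : i ≤ j) (t : ℝ) :
    ‖iteratedFDeriv ℝ i (fun t => curveProfile μ S C t - klAngularMean (curveProfile μ S C)) t‖ ≤ bellCum M D j := by
  refine le_trans ?_ (bellTerm_le_bellCum hMnn hDnn hi)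
  rw [norm_iteratedFDeriv_eq_norm_iteratedDeriv, Real.norm_eq_abs]
  rcases Nat.eq_zero_or_pos i with rfl | hipos
  · -- order zero: `|p − mean p| ≤ 2 M₀`
    simp only [iteratedDeriv_zero, bellTerm]
    have hp : ∀ θ, |curveProfile μ S C θ| ≤ M 0 := fun θ => by
      rw [curveProfile_eq_comp]; exact hM0 _
    calc |curveProfile μ S C t - klAngularMean (curveProfile μ S C)|
        ≤ |curveProfile μ S C t| + |klAngularMean (curveProfile μ S C)| := abs_sub _ _
      _ ≤ M 0 + M 0 := add_le_add (hp t) (abs_klAngularMean_le' hp)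
      _ = 2 * M 0 := by ring
  · -- positive order: the constant drops, Bell bound
    have e : (fun t => curveProfile μ S C t - klAngularMean (curveProfile μ S C)) =
        fun t => -klAngularMean (curveProfile μ S C) + curveProfile μ S C t := by funext t; ring
    rw [e, iteratedDeriv_const_add hipos, curveProfile_eq_comp]
    have hB := abs_iteratedDeriv_comp_le_bell (contDiff_evalM S) hγ (θ := t) (M := M) (D := D)
      (fun k hk1 hk4 => hM k hk1 hk4 _) (fun i hi1 hi4 => hD i hi1 hi4 t)
    have hi4 : i ≤ 4 := hi.trans hj
    interval_cases i
    · simpa [bellTerm] using hB.1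
    · simpa [bellTerm] using hB.2.1
    · simpa [bellTerm] using hB.2.2.1
    · simpa [bellTerm] using hB.2.2.2

end Summit.HubbardSuperconductivity.HubbardSuperconductivity.Theorems.KLRegimeSplit

end
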